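/-
Copyright: cell `langlands-arthur-audit` (papers/Langlands/langlands-arthur-audit), unit `pub-arthur-up-g49`
(literature-prover-pub-arthur-up-g49-0, 2026-08-21).  Staged for the tree under
`Literature/NumberTheory/Automorphic/Arthur2013/Leaves/` (LEAN-IN-TREE rule 2026-08-18).  Module map M165 (v1 = p251713;
v1.1, same unit, same day: locator / label precision only — §5.1 vs §5.2 of FP22, AGIKMS's printed label « [Ber2] », BBK18's
display in its exact TeX, and the Schneider–Stuhler formulas marked as READINGS of the NUMDAM text layer (OCR-grade) rather than
quotations; one data string changed (`citedFor .AGIKMS`), no statement of any theorem changed).  v1.2, same unit, same day: APPEND-ONLY §5 « What the cited notes print at Theorem 31 » (a read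
register of the unpublished UBC copy the users cite — items (1)–(5) verbatim, (4) = induction with the opposite parabolic;
nothing above it changed).  Imports `HarnessLib` only.  A REGISTER module of the UPSTREAM line (third tier / preprint layer of the [KMSW] and
[AGIKMS] columns): every declaration types a PRINTED statement with its `[cite: …]` locus, or is a `decide`/`rfl`
register over such data, or (§4) the one-line assembly of two printed theorems into the statement the three user
texts cite to unpublished lecture notes.  No `axiom`, no `sorry`, no `opaque`; status words of the cell's census are
not touched (the consuming nodes `KMSW_AppA` / AGIKMS App. B / `CK26` are PREPRINT or CLOSED already).
-/
import HarnessLib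

/-!
# Arthur (2013) audit, typed leaves — the INDUCTION PROPERTY of Aubert / cohomological duality: cited by its 2014,
# 2024–26 users only to Bernstein's unpublished Harvard notes (1992); a REFEREED printed proof exists since 2022

**The statement.**  For a connected reductive group `G` over a non-archimedean local field, a parabolic `P = MN`
with opposite `P̄ = M N̄`, and a smooth representation `π` of `M` of finite length: « the Aubert dual of
`Ind_P^G(π)` is isomorphic to `Ind_{P̄}^G(π̂)` » — at the level of REPRESENTATIONS (not only in the Grothendieck
group, where it is Aubert's [Aub95, Thm 1.7]).  Its three user texts in the cell's cone print it and cite it thus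
(all loci first-hand on the staged sources, cell CITED-FACTS3 §UP-g49):

* [KMSW] = Kaletha–Mínguez–Shin–White, arXiv:1409.3731v3, Appendix A (`Appendix_Ban.tex`), l.103–106:
  « {\bf Induction.} If $P$ is a parabolic subgroup of $G$ with Levi component $M$  then \cite[Theorem
  31(3)]{Bernstein} \begin{equation}\label{ap:ber} \widehat{i_P^G(\cdot)} = i_{P^-}^G(\widehat{\cdot}).
  \end{equation} » — used at l.284 (« We deduce the commutativity of the diagram by \eqref{ap:ber}. », proof of
  the R-group proposition of App. A); `main.bbl` l.85 « \bibitem[Ber]{Bernstein} Joseph Bernstein,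
  \emph{Representations of {$p$}-adic groups}. » (no venue, no year).  The involution itself is introduced at
  l.94–96: « Schneider-Stuhler in  \cite[III.3.1]{SchStu} and Bernstein-Bezrukavnikov in \cite[IV.5.1]{Bernstein}
  and \cite[\textsection 4]{Bezru} have defined, in terms of cohomology, an involution $\mc{E}:\tx{Alg}^{\tx{fl}}
  _\chi(\Omega) \longrightarrow \tx{Alg}^{\tx{fl}}_{\chi^{-1}}(\Omega)$ that coincides, by \cite[p. 184]{SchStu},
  with the contragredient of the Aubert involution. That is, for every $\pi \in \tx{Alg}^{\tx{fl}}_\chi(\Omega)$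
  we have that $\mc{E}(\pi^\vee)=\widehat{\pi}$. » (π̂ = the cokernel of Aubert's exact sequence, l.83–88).
* [AGIKMS] = Atobe–Gan–Ichino–Kaletha–Mínguez–Shin, arXiv:2410.13504v3, Appendix B (`note30.tex`): Definition
  l.11701–11707 « For $\pi \in \Rep(G)_t$, set \[ \hat\pi = \tl{X}_t(\pi)/d_{t+1}(\tl{X}_{t+1}(\pi)) \] and call
  $\hat\pi$ the \emph{Aubert dual} of $\pi$. » (the top homology of the Deligne–Lusztig-type complex
  `0 → X̃_r(π) → ⋯ → X̃_0(π)` of l.11656–11674); Theorem B.2.3 = `\label{AD}` (5), l.11731–11735: « Let $P$ be a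
  parabolic subgroup of $G$ with Levi component $M$, and denote by $\overline{P}$ the parabolic subgroup of $G$
  opposite to $P$. Then for $\pi \in \Rep(M)$ of finite length, the Aubert dual of $\Ind_P^G(\pi)$ is isomorphic
  to $\Ind_{\overline{P}}^G(\hat\pi)$. »; proof l.11739–11743: « For (1), see \cite[III.3]{SS}. The assertions
  (2), (3) and (4) are \cite[Corollaire 3.9]{Au}. Finally, (5) is \cite[Theorem 31 (4)]{Ber}. »; used at
  l.11791–11792 (« Note that $\widehat{I_P(\pi_s)} \cong I_{\overline{P}}(\hat\pi_s)$ as representations of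
  $G^\circ$ by Theorem \ref{AD} (5). », intertwining operators vs Aubert duality) and named at l.11977 (« an
  analogue of Theorem \ref{AD} (5) will not be established » for O_{2n}); bibliography l.16089–16092 « \bibitem[Ber2]{Ber}
  {I.N. Bernstein}, {\em Representations of $p$-adic groups}. Available at:\\ \url{https://personal.math.ubc.ca/~cass/
  research/pdf/bernstein.pdf}. » (printed label [Ber2]; cite key `Ber`).
* [CK26] = Cheng–Kaletha, arXiv:2607.10660v1 (12 Jul 2026), p. 12, Proposition 2.5.3: « The cohomological
  duality D^G_B satisfies the following properties: 1. D^G_B is an involution … 2. D^G_B ∘ i^G_P is equivalent to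
  i^G_{P⁻} ∘ D^M_B. 3. D^M_B ∘ r^G_P is equivalent to r^G_P ∘ D^G_B. 4. D^G_B preserves irreducibility … » with
  « Proof. The first four properties are proved in [Ber92, Theorem 31]. See also [Che26a] for an exposition.
  Property (5) is the main result of [Che26b]. Property (6) is the main result of [BBK18]. »; p. 54 « [Ber92]
  Joseph Bernstein, Representations of p-adic groups, Lectures at Harvard University, Fall 1992; written by Karl
  E. Rumelhart; unpublished lecture notes, 1992. », p. 55 « [Che26a] Yongshen Cheng, Functorial dualities for
  representations of p-adic groups, Master Thesis, 2026. » (cell CITED-FACTS UP-59).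

None of the three texts cites a PUBLISHED proof of the representation-level induction property (the cell's
reading so far, GAPS G-UP-37/40: « cited only to unpublished notes (1992) + a 2026 Master thesis; no published
proof located or cited by the 2026 users »; G-UP-37 left open « whether any of [Aubert 1995, Schneider–Stuhler
1997, BBK 2018] prints statement (5) at the level of representations »).

**What this module registers (first-hand, 2026-08-21).**
(1) Frățilă–Prasad, *Homological duality for covering groups of reductive p-adic groups*, Pure Appl. Math. Q.
**18** (2022) no. 5, 1867–1950 (doi:10.4310/pamq.2022.v18.n5.a2; Zbl 1510.11114, signed review; MR4538041; =
arXiv:2106.00437, v1 2021-06-01, v2 2022-08-04 « To appear in Pure Appl. Math. Q. in a volume in honor of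
Benedict Gross »; bib `FratilaPrasad2022`; read on arXiv v2 = cell corpus `paper:arxiv-2106.00437`, loci
`pNNNN:Ln` of that text, and on the arXiv PDF) PRINTS AND PROVES IN FULL, for `G̃` ANY finite central extension
of `G = 𝔾(F)` (§3.1: kernel « a finite abelian group μ »; §1.1 first sentence « Let $G$ be a reductive $p$-adic
group or a covering group (finite central extension) of such a group. » — the trivial extension is the linear
case), **Proposition 10.3** (§10.2, p0034:L73–80): « Let $\wP = \wL N$ be a parabolic with Levi decomposition in
$\wG$. We have the following natural isomorphisms of functors when restricted to the bounded derived category of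
finitely generated smooth $\wG$-modules $\cD^b_{fg}(\cM(\wG))$: * $D_h \bfi_{\wL,\wP}^\wG \simeq
\bfi_{\wL,\wP^-}^\wG D_h$, * $D_h \bfr_{\wL,\wP}^\wG \simeq \bfr_{\wL,\wP}^\wG D_h$. » for `D_h =
RHom_{H(G̃)}(−, H(G̃))` (§10.1 (10.1)), with the sentence « We follow the proof of the linear case from [Ber92,
Theorem 31(4,5)]. » (§10.2, arXiv PDF; the printed proof: finite projective resolutions, second adjointness Thm
8.15 « The functor $\bfi_{\wL,\wP}^\wG$ is left adjoint to $\bfr_{\wL,\wP^-}^\wG$. » — « Other references for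
the linear case are [Ber92, Theorem 19], [Bus01], and [BK15] », i.e. Bushnell, J. London Math. Soc. 63 (2001) and
Bezrukavnikov–Kazhdan, Represent. Theory 19 (2015) in refereed print —, and the bimodule identities (10.6)); the
intro states it as Theorem 1.3 (4) « $D_h \circ \mathbf{i}_{\widetilde{L},\widetilde{P}}^{\widetilde{G}} =
\mathbf{i}_{\widetilde{L},\widetilde{P}^-}^{\widetilde{G}} \circ D_h$ and $D_h \circ \mathbf{r} … = \mathbf{r} …
\circ D_h$ » and Theorem 10.2 (p0034:L34) « If $\pi\in\cM(\wG)_\fs$ is of finite length, then $D_h(\pi)$ has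
cohomology only in degree $d(\fs)$. »  (2) Bernstein–Bezrukavnikov–Kazhdan, *Deligne–Lusztig duality and
wonderful compactification*, Selecta Math. (N.S.) **24** (2018) 7–20 (doi:10.1007/s00029-018-0391-5; Zbl
1496.20075; bib `BernsteinBezrukavnikovKazhdan2018`; arXiv:1701.07329 source `DL.tex` of 2018-10-11, l.496–502)
Theorem 1.1: « For a complex $M$  with admissible cohomology  we have a canonical quasi-isomorphism
$$DL(\check{M})\cong RHom_H(M,H)[r],$$ where $\check{M}$ denotes the contragradient representation, $H\cong
C_c^\infty(G)$ is the regular bimodule for the Hecke algebra and $r$ is the split rank of the center of $G$. »,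
`DL(M)` = the complex of l.476–479 « Let $G$ be a reductive $p$-adic group. For every smooth $G$-module $M$ one can form a complex
$$0\to M \to \oplusl_P %{\corank(P)=1} i_P^Gr_P^G(M)\to \cdots \to i_B^Gr_B^G(M)\to 0,$$ » (TeX verbatim, `\oplusl` their
macro; summation over conjugacy classes of parabolics of corank i, l.480–486) — the complex of which the users' Aubert dual is the
non-zero homology; l.641 « passing to the contragradient module
commutes with unitary parabolic induction ».  (3) Schneider–Stuhler, Publ. Math. IHÉS **85** (1997) 97–191 (NUMDAM
text = cell `paper:url-37b955455ef0`, printed page = PDF page + 95; bib `SchneiderStuhler1997`; the text layer is OCR-grade: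
WORDS below are quoted, FORMULAS are this module's READINGS of garbled displays, marked ⟦…⟧): what [KMSW]'s « [SchStu, p. 184] »
prints is the GROTHENDIECK-GROUP identity — IV.5 p.183 « We fix a central character χ and let R_ℤ(G; χ) be the Grothendieck
group of representations of finite length in Alg_χ(G) (w.r.t. exact sequences) », the map ι on R_ℤ(G; χ) built from the classes
of the ℰ^i(V)~ (« is a well-defined homomorphism such that » ⟦ι([V]) = (−1)^{d−#Θ}[ℰ(V)~] for V in Alg_{χ,Θ}(G)⟧), Prop. IV.5.1
p.184 « The homomorphism ι respects up to sign the classes of irreducible representations. », Prop. IV.5.2 p.184 « For any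
representation V of finite length in Alg_χ(G) we have » ⟦ι([V]) = Σ_{Θ⊂Δ} (−1)^{#Θ} [Ind_Θ(V_{U_Θ})]⟧, Lemma IV.5.3 p.184 (« let
P_{−Θ} be the parabolic subgroup of G which contains M_Θ and is opposite to P_Θ »; ⟦the class of Ind_Θ(E) equals the class of
the induction of the corresponding Jacquet-type datum from the opposite side⟧, E of finite length), Prop. IV.5.4 p.185 « For
any representation V in Alg_{χ,Θ}(G) we have » ⟦[ℰ(V)] = ι([V])~⟧, Cor. IV.5.5 « The map ι is an involution, i.e. ι ∘ ι = id. »,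
p.185 « The Proposition 2 shows that » ⟦(−1)^d·ι⟧ « coincides with the involution D_G studied in [Au1] 5.24 » —, while its
Theorem III.2.2 p.131 is the induction statement for IRREDUCIBLE SUPERCUSPIDAL inducing data only: « A key result of this
paper which will be established in the Chapter IV (IV. 4.18) is the following. Theorem III.2.2. — Let E be an irreducible
supercuspidal representation in » ⟦Alg_χ(M_Θ)⟧ «, there is a subset » ⟦Θ′ ⊂ Δ⟧ « associated to » ⟦Θ⟧ « such that » ⟦ℰ^*(Ind_Θ(E)) ≅
Ind_{Θ′}(ᵍẼ) if * = d − #Θ, 0 otherwise⟧; III.2 p.131 also prints « The reason for introducing the character » ⟦δ_Θ⟧ « is the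
formula » ⟦Ind_Θ(E)~ = Ind_Θ(Ẽ)⟧ « ([Cas] 3.1.2) for the smooth dual » ⟦Ẽ⟧ (cell CITED-FACTS3 UP-1123/1124 carry the raw text layer).

**Reading (status-neutral).**  At STATEMENT level the property the three texts cite to [Ber92, Thm 31(3)/(4)]
— `D ∘ i_P^G ≃ i_{P̄}^G ∘ D` for Bernstein's cohomological duality `D = RHom_{H(G)}(−, H(G))` on finitely
generated (in particular finite-length) smooth representations — has a refereed printed proof since 2022 (FP22
Prop. 10.3 (1), linear case = trivial cover); the passage from `D_h` to the users' Aubert dual `π̂` of a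
finite-length `π` is BBK18 Thm 1.1 (refereed 2018; `π̂ ≅ 𝔻_h(π^∨)` up to the printed shift) together with the
commutation of contragredient with normalized induction (SS97 III.2 quoting [Cas] 3.1.2; BBK18 l.641) and the
one-degree concentration (FP22 Thm 10.2 / BBK18 Thm 3.3 / SS97 III.3.1); §4 below assembles these printed inputs
into Thm B.2.3 (5) / (A.ber) in the kernel, on isomorphism classes.  Before 2022 the representation-level
statement was in print only for irreducible supercuspidal inducing data (SS97 III.2.2) and in the Grothendieck
group (Aubert 1995; SS97 IV.5).  NOT READ: the PAMQ version of record's body (publisher site Cloudflare-blocked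
2026-08-21; the refereed status rests on Crossref / zbMATH / MR and arXiv v2's « To appear »); Bernstein's notes
themselves are not quoted as a source (unpublished; they are what the users cite).  The cell's census words and
the words of rows K1 / KL11 are the judge's (Q-UP-49-a); this module changes none.
-/

set_option autoImplicit false

namespace Literature.NumberTheory.Automorphic.Arthur2013.Leaves.AubertInduction

/-! ## 1. The three user texts and how each cites the induction property -/

/-- The texts of the cell's cone that USE the representation-level induction property of Aubert / cohomological
duality. [cite: KalethaEtAl2014, Appendix A `Appendix_Ban.tex` l.103–106; AGIKMS2024, App. B Thm B.2.3 (5) `note30.tex` l.11731–11735; ChengKaletha2026, Prop. 2.5.3 (2) p. 12] -/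
inductive User
  | KMSW
  | AGIKMS
  | CK26
  deriving DecidableEq, Repr

/-- All three users. [cite: KalethaEtAl2014, `Appendix_Ban.tex` l.103; AGIKMS2024, `note30.tex` l.11742; ChengKaletha2026, p. 12] -/
def User.all : List User := [.KMSW, .AGIKMS, .CK26]

/-- Per user: (arXiv id × version read, source line (or PDF page for [CK26]) of the STATEMENT, line/page of the
CITATION, item of Bernstein's « Theorem 31 » cited (0 = the theorem as a whole), year of the text read).
[cite: KalethaEtAl2014, `Appendix_Ban.tex` l.103–106 « \cite[Theorem 31(3)]{Bernstein} \widehat{i_P^G(\cdot)} = i_{P^-}^G(\widehat{\cdot}) »; AGIKMS2024, `note30.tex` l.11731–11735 (statement), l.11742 « Finally, (5) is \cite[Theorem 31 (4)]{Ber}. »; ChengKaletha2026, p. 12 Prop. 2.5.3 (2) « D^G_B ∘ i^G_P is equivalent to i^G_{P⁻} ∘ D^M_B » + « The first four properties are proved in [Ber92, Theorem 31]. »] -/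
def citation : User → String × Nat × Nat × Nat × Nat
  | .KMSW   => ("arXiv:1409.3731v3 Appendix_Ban.tex", 105, 103, 3, 2014)
  | .AGIKMS => ("arXiv:2410.13504v3 note30.tex", 11735, 11742, 4, 2026)
  | .CK26   => ("arXiv:2607.10660v1 (PDF page)", 12, 12, 0, 2026)

/-- Per user: the sources it cites FOR THIS PROPERTY, as (label as printed, refereed journal/series print?, year
as printed (0 = none printed)).  [KMSW] and [AGIKMS] cite Bernstein's notes alone for the induction item; [CK26]
adds a 2026 Master thesis « for an exposition ».  (The DEFINITION of the involution is co-cited by [KMSW] l.94 to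
Schneider–Stuhler III.3.1 — refereed 1997 — and by [AGIKMS] Thm B.2.3 (1) to « [SS, III.3] »; those are not
citations for the induction item.)
[cite: KalethaEtAl2014, `main.bbl` l.85 « \bibitem[Ber]{Bernstein} Joseph Bernstein, \emph{Representations of {$p$}-adic groups}. »; AGIKMS2024, `note30.tex` l.16089–16092 « \bibitem[Ber2]{Ber} {I.N. Bernstein}, {\em Representations of $p$-adic groups}. Available at: » (URL); ChengKaletha2026, p. 54 [Ber92] « unpublished lecture notes, 1992 », p. 55 [Che26a] « Master Thesis, 2026 »] -/
def citedFor : User → List (String × Bool × Nat)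
  | .KMSW   => [("[Ber] Joseph Bernstein, Representations of p-adic groups (no venue, no year)", false, 0)]
  | .AGIKMS => [("[Ber2] (cite key Ber) I.N. Bernstein, Representations of p-adic groups. Available at: personal.math.ubc.ca/~cass/research/pdf/bernstein.pdf (no venue, no year)", false, 0)]
  | .CK26   => [("[Ber92] Lectures at Harvard University, Fall 1992; written by Karl E. Rumelhart; unpublished lecture notes", false, 1992),
                ("[Che26a] Yongshen Cheng, Functorial dualities for representations of p-adic groups, Master Thesis", false, 2026)]

/-- Does the user text cite Frățilă–Prasad 2022 anywhere (grep of the staged sources / cell text, 2026-08-21: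
`Fratila|Frăţilă|pamq|Homological duality for covering` → no match in `src/1409.3731/*`, `src/2410.13504/*`,
`paper:arxiv-2607.10660`)? [cite: KalethaEtAl2014, `main.bbl` (71 entries, cell UP-45); AGIKMS2024, bibliography l.16080 ff.; ChengKaletha2026, pp. 54–56] -/
def citesFP22 : User → Bool
  | .KMSW => false | .AGIKMS => false | .CK26 => false

/-! ## 2. The printed suppliers, at statement level -/

/-- The published statements this module reads as supplying the property (or a part / special case of it).
[cite: FratilaPrasad2022, Prop. 10.3, Thm 10.2, Thm 8.15; BernsteinBezrukavnikovKazhdan2018, Thm 1.1, Thm 3.3; SchneiderStuhler1997, Thm III.2.2 p. 131, Prop. IV.5.4 p. 185; Aubert1995, Thm 1.7 / Cor. 3.9 (as cited by AGIKMS l.11741)] -/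
inductive Supply
  /-- FP22 Prop. 10.3 (1): `D_h ∘ i_{L̃,P̃}^{G̃} ≃ i_{L̃,P̃⁻}^{G̃} ∘ D_h` on `D^b_fg(M(G̃))`. -/
  | FP22_Prop103_1
  /-- FP22 Prop. 10.3 (2): `D_h ∘ r_{L̃,P̃}^{G̃} ≃ r_{L̃,P̃}^{G̃} ∘ D_h`. -/
  | FP22_Prop103_2
  /-- FP22 Thm 10.2: finite length in a block ⇒ `D_h(π)` concentrated in degree `d(𝔰)`. -/
  | FP22_Thm102
  /-- FP22 Thm 8.15: second adjointness (`i_{P̃}` left adjoint to `r_{P̃⁻}`) for covers; linear case cited to [Bus01], [BK15]. -/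
  | FP22_Thm815
  /-- BBK18 Thm 1.1: `DL(M̌) ≅ RHom_H(M,H)[r]` for complexes with admissible cohomology. -/
  | BBK18_Thm11
  /-- BBK18 Thm 3.3: `DL(M)` of an admissible `M` in a component of dimension `d` has cohomology in degree `d − r` only. -/
  | BBK18_Thm33
  /-- SS97 Thm III.2.2 (reading of the text layer): `ℰ^{d−#Θ}(Ind_Θ E) ≅ Ind_{Θ′}(ᵍẼ)` for E IRREDUCIBLE SUPERCUSPIDAL (special case). -/
  | SS97_III22
  /-- SS97 Prop. IV.5.4 (p. 185; with IV.5.2/5.3 p. 184; formula = reading of the text layer): `[ℰ(V)] = ι([V])~` in the Grothendieck group R_ℤ(G; χ). -/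
  | SS97_IV54
  /-- Aubert 1995 (Thm 1.7 / Cor. 3.9): the involution D_G on the Grothendieck group commutes with i_M^G — Grothendieck level. -/
  | Aub95_Groth
  deriving DecidableEq, Repr

/-- All suppliers registered. [cite: FratilaPrasad2022, §10; BernsteinBezrukavnikovKazhdan2018, §§1, 3; SchneiderStuhler1997, III.2, IV.5; Aubert1995, §1] -/
def Supply.all : List Supply :=
  [.FP22_Prop103_1, .FP22_Prop103_2, .FP22_Thm102, .FP22_Thm815, .BBK18_Thm11, .BBK18_Thm33, .SS97_III22,
   .SS97_IV54, .Aub95_Groth]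

/-- What kind of statement a supplier prints, relative to the users' property (a classification of the printed statements
registered in `Supply`, no content of its own). [cite: FratilaPrasad2022, Prop. 10.3 (1) (representation level); SchneiderStuhler1997, Thm III.2.2 p. 131 (special case), Prop. IV.5.4 p. 185 (Grothendieck group); Aubert1995, Thm 1.7 (Grothendieck group); BernsteinBezrukavnikovKazhdan2018, Thm 1.1 (bridge)] -/
inductive Level
  /-- the induction property itself, for the cohomological duality, at the level of (complexes of) representations -/
  | repLevelInduction
  /-- an ingredient of the passage cohomological duality ↔ Aubert dual (DL complex), or of the proof -/
  | bridge
  /-- the property for a special class of inducing data only -/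
  | specialCase
  /-- the property in the Grothendieck group only -/
  | grothendieckOnly
  deriving DecidableEq, Repr

/-- Supplier record: (year of the refereed print, refereed journal/series?, level, venue + locator as read).
[cite: FratilaPrasad2022, Prop. 10.3 (1)/(2) (§10.2; corpus `paper:arxiv-2106.00437` p0034:L73–80), Thm 10.2 (p0034:L34), Thm 8.15 (p0030:L103–104); BernsteinBezrukavnikovKazhdan2018, Thm 1.1 (arXiv source l.496–502), Thm 3.3; SchneiderStuhler1997, Thm III.2.2 p. 131, Prop. IV.5.4 p. 185; Aubert1995, Thm 1.7, Cor. 3.9] -/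
def supplyRec : Supply → Nat × Bool × Level × String
  | .FP22_Prop103_1 => (2022, true, .repLevelInduction,
      "Pure Appl. Math. Q. 18 (2022) no. 5, 1867–1950, Prop. 10.3 (1): D_h i_{L~,P~} ≃ i_{L~,P~^-} D_h on D^b_fg(M(G~)); G~ any finite central extension of reductive p-adic G (§3.1), trivial extension included (§1.1)")
  | .FP22_Prop103_2 => (2022, true, .bridge,
      "ibid., Prop. 10.3 (2): D_h r_{L~,P~} ≃ r_{L~,P~} D_h")
  | .FP22_Thm102   => (2022, true, .bridge,
      "ibid., Thm 10.2: finite length in block s ⇒ D_h(π) concentrated in degree d(s) (« following [Ber92, Theorem 31] »)")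
  | .FP22_Thm815   => (2022, true, .bridge,
      "ibid., Thm 8.15 (second adjointness for covers; « Other references for the linear case are [Ber92, Theorem 19], [Bus01], and [BK15] »)")
  | .BBK18_Thm11   => (2018, true, .bridge,
      "Selecta Math. (N.S.) 24 (2018) 7–20, Thm 1.1: DL(M̌) ≅ RHom_H(M,H)[r] for complexes with admissible cohomology")
  | .BBK18_Thm33   => (2018, true, .bridge,
      "ibid., Thm 3.3: DL(M), M admissible in a component of dimension d, has cohomology in degree d − r only")
  | .SS97_III22    => (1997, true, .specialCase,
      "Publ. Math. IHÉS 85 (1997) Thm III.2.2 p. 131: ℰ^{d−#Θ}(Ind_Θ E) ≅ Ind_{Θ′}(ᵍẼ), E irreducible supercuspidal, Θ′ associated to Θ")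
  | .SS97_IV54     => (1997, true, .grothendieckOnly,
      "ibid., Prop. IV.5.4 p. 185 (with IV.5.2, Lemma IV.5.3 p. 184): [ℰ(V)] = ι([V])~ in R_ℤ(G; χ)")
  | .Aub95_Groth   => (1995, true, .grothendieckOnly,
      "Trans. AMS 347 (1995) 2179–2189 (+ erratum 348 (1996)): D_G on the Grothendieck group; commutation with i_M^G (as cited: AGIKMS l.11741 « (2), (3) and (4) are [Au, Corollaire 3.9] »)")

/-- Year of the refereed print of a supplier. [cite: FratilaPrasad2022, Crossref « published-print 2022 », Zbl 1510.11114; BernsteinBezrukavnikovKazhdan2018, Crossref issued 2018-01-23, Zbl 1496.20075; SchneiderStuhler1997, vol. 85 (1997); Aubert1995, vol. 347 (1995)] -/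
def Supply.year (s : Supply) : Nat := (supplyRec s).1

/-- Level of a supplier. [cite: FratilaPrasad2022, Prop. 10.3; SchneiderStuhler1997, III.2.2, IV.5.4; Aubert1995, Thm 1.7] -/
def Supply.level (s : Supply) : Level := (supplyRec s).2.2.1

/-- FP22's scope as printed (§3.1 / §1.1 / §10.2): base field, groups, coefficients, category on which Prop. 10.3
is stated, whether the trivial central extension is included, whether the proof is printed in the paper.
[cite: FratilaPrasad2022, §3.1 « Let $G=\bG(F)$ be the locally compact group of $F$-rational points of a reductive linear algebraic group $\bG$ over a non-archimedean local field $F$. Let $\wG$ be a finite central extension of $G$ with kernel a finite abelian group ${\mu}$ … that is moreover a topological covering. » (p0015:L5–12); §3.2 « All representations will be on complex vector spaces. » (p0015:L17); §1.1 « Let $G$ be a reductive $p$-adic group or a covering group (finite central extension) of such a group. » (p0003:L5); Prop. 10.3 « when restricted to … $\cD^b_{fg}(\cM(\wG))$ » (p0034:L75); §10.2 proof p0034:L82 ff.] -/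
structure FP22Scope where
  baseField : String := "non-archimedean local field F (any characteristic)"
  groups : String := "G~ = any finite central extension (topological covering, finite abelian kernel μ) of G = G(F), G reductive linear algebraic over F"
  coefficients : String := "complex smooth representations"
  category : String := "bounded derived category of finitely generated smooth G~-modules D^b_fg(M(G~))"
  trivialExtensionIncluded : Bool := true
  proofPrinted : Bool := true
  deriving Repr

/-- The scope record. [cite: FratilaPrasad2022, §3.1, §1.1, Prop. 10.3] -/
def fp22Scope : FP22Scope := {}

/-- REGISTER FACT (by `decide`).  (i) Every one of the three user texts cites, FOR the induction property, only
texts that are not refereed print (Bernstein's notes; [CK26] adds a 2026 Master thesis), and none cites FP22;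
(ii) among the registered suppliers exactly one prints the representation-level induction property for the
cohomological duality itself — FP22 Prop. 10.3 (1), refereed, 2022 —; the 1995/1997 prints are Grothendieck-group
statements or the irreducible-supercuspidal special case; (iii) FP22's printed scope includes the trivial
extension (the linear groups of the users) and prints the proof.  No census word is touched.
[cite: KalethaEtAl2014, `Appendix_Ban.tex` l.103, `main.bbl` l.85; AGIKMS2024, `note30.tex` l.11742, l.16089; ChengKaletha2026, p. 12, pp. 54–55; FratilaPrasad2022, Prop. 10.3 (1), §1.1, §3.1; SchneiderStuhler1997, III.2.2 p. 131, IV.5.4 p. 185; Aubert1995, Thm 1.7; BernsteinBezrukavnikovKazhdan2018, Thm 1.1] -/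
theorem induction_property_in_refereed_print_2022 :
    User.all.all (fun u => (citedFor u).all (fun c => !c.2.1) && !(citesFP22 u)) = true
    ∧ (Supply.all.filter fun s => s.level == .repLevelInduction) = [.FP22_Prop103_1]
    ∧ (Supply.year .FP22_Prop103_1, (supplyRec .FP22_Prop103_1).2.1) = (2022, true)
    ∧ (Supply.all.filter fun s => decide (s.year < 2018)).all
        (fun s => s.level == .grothendieckOnly || s.level == .specialCase) = true
    ∧ fp22Scope.trivialExtensionIncluded = true ∧ fp22Scope.proofPrinted = true
    ∧ (User.all.map fun u => (citation u).2.2.2.1) = [3, 4, 0] := by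
  decide

/-! ## 3. The numbering of « Theorem 31 » across the texts (bookkeeping) -/

/-- The item of Bernstein's Theorem 31 each text names for the INDUCTION statement: [KMSW] « 31(3) », [AGIKMS]
« 31 (4) », FP22 « 31(4,5) » (induction and restriction), [CK26] the theorem as a whole.  A register of what is
printed; the notes are not adjudicated here. [cite: KalethaEtAl2014, `Appendix_Ban.tex` l.103; AGIKMS2024, `note30.tex` l.11742; FratilaPrasad2022, §10.2 « We follow the proof of the linear case from [Ber92, Theorem 31(4,5)]. » (arXiv v2 PDF; the corpus TeX rendering drops optional cite arguments); ChengKaletha2026, p. 12] -/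
def thm31ItemsNamed : List (String × List Nat) :=
  [("KMSW 2014 App. A", [3]), ("AGIKMS v3 App. B", [4]), ("Fratila–Prasad 2022 §10.2", [4, 5]), ("Cheng–Kaletha 2026 Prop. 2.5.3", [])]

/-- The two texts that give an item number for induction alone disagree (3 vs 4); FP22's pair {4, 5} contains
AGIKMS's item. [cite: KalethaEtAl2014, l.103; AGIKMS2024, l.11742; FratilaPrasad2022, §10.2] -/
theorem thm31_numbering_differs :
    (thm31ItemsNamed.map (·.2)) = [[3], [4], [4, 5], []] ∧ (4 ∈ [4, 5]) ∧ ¬ (3 ∈ [4, 5]) := by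
  decide

/-! ## 4. The assembly: Thm B.2.3 (5) / (A.ber) from the printed statements, on isomorphism classes

A deliberately thin typed skeleton: `RG`, `RM` stand for isomorphism classes of finite-length smooth
representations of `G` and of the Levi `M` (one Bernstein block at a time, so that the cohomological dual is a
single representation by FP22 Thm 10.2 / BBK18 Thm 3.3 / SS97 III.3.1); the functors are maps on classes.  The
four hypotheses are the PRINTED statements named in their docstrings, read on classes; the conclusion is the
users' statement.  Nothing about p-adic groups is formalised — the point checked by the kernel is only that the
users' item follows from the 2018 + 2022 prints by a two-line substitution, with the opposite parabolic entering
exactly once (through FP22) and the contragredient cancelling. -/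

/-- The maps on isomorphism classes entering the assembly. [cite: AGIKMS2024, `note30.tex` l.11701–11707 (Aubert dual), l.11731–11735 (Ind_P, Ind_{P̄}); FratilaPrasad2022, §10.1 (10.1) (D_h), §5.1 (P̃⁻ « the opposite parabolic with Levi decomposition $LN^-$ »), §5.2 (i_{L̃,P̃}); BernsteinBezrukavnikovKazhdan2018, l.476–479 (DL), l.499 (contragredient)] -/
structure DualityMaps (RG RM : Type) where
  /-- normalized parabolic induction `i_P^G` on classes -/
  indP : RM → RG
  /-- normalized parabolic induction from the OPPOSITE parabolic `i_{P̄}^G` -/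
  indPbar : RM → RG
  /-- Bernstein's cohomological dual `𝔻_h` on `G` (the single non-zero cohomology of `RHom_{H(G)}(−, H(G))`) -/
  dualG : RG → RG
  /-- the same on `M` -/
  dualM : RM → RM
  /-- contragredient on `G` -/
  contraG : RG → RG
  /-- contragredient on `M` -/
  contraM : RM → RM
  /-- the Aubert dual on `G` (top homology of the DL complex; AGIKMS Def. before Thm B.2.3, KMSW l.83–88) -/
  aubG : RG → RG
  /-- the Aubert dual on `M` -/
  aubM : RM → RM

variable {RG RM : Type}

/-- The PRINTED inputs, read on isomorphism classes of finite-length representations in a block.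
`dl_eq_dual_contra_G/M`: BBK18 Thm 1.1 « DL(M̌) ≅ RHom_H(M,H)[r] » (so the Aubert dual of `π` is `𝔻_h(π^∨)`;
for [KMSW] this is their own sentence l.96 « 𝓔(π^∨) = π̂ », there cited to [SchStu, p. 184], which prints it in
the Grothendieck group, Prop. IV.5.4); `dual_ind`: FP22 Prop. 10.3 (1) « D_h i_{L̃,P̃} ≃ i_{L̃,P̃⁻} D_h »;
`contra_ind`: SS97 III.2 p. 131 (« the formula » ⟦Ind_Θ(E)~ = Ind_Θ(Ẽ)⟧ « ([Cas] 3.1.2) for the smooth dual ») and BBK18 l.641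
« passing to the contragradient module commutes with unitary parabolic induction » (normalized induction). [cite: BernsteinBezrukavnikovKazhdan2018, Thm 1.1 (l.496–502), l.641; FratilaPrasad2022, Prop. 10.3 (1); SchneiderStuhler1997, III.2 p. 131; KalethaEtAl2014, `Appendix_Ban.tex` l.94–96] -/
structure PrintedInputs (d : DualityMaps RG RM) : Prop where
  /-- BBK18 Thm 1.1 on `G`: Aubert dual = cohomological dual of the contragredient -/
  dl_eq_dual_contra_G : ∀ x : RG, d.aubG x = d.dualG (d.contraG x)
  /-- BBK18 Thm 1.1 on `M` -/
  dl_eq_dual_contra_M : ∀ y : RM, d.aubM y = d.dualM (d.contraM y)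
  /-- FP22 Prop. 10.3 (1): cohomological duality turns `i_P` into `i_{P̄}` -/
  dual_ind : ∀ y : RM, d.dualG (d.indP y) = d.indPbar (d.dualM y)
  /-- contragredient commutes with normalized parabolic induction ([Cas] 3.1.2 as cited by SS97 III.2 p. 131; BBK18 l.641) -/
  contra_ind : ∀ y : RM, d.contraG (d.indP y) = d.indP (d.contraM y)

/-- **[AGIKMS] Thm B.2.3 (5) = [KMSW] (A.ber) = [CK26] Prop. 2.5.3 (2) (up to BBK18), from the printed inputs.**
« the Aubert dual of $\Ind_P^G(\pi)$ is isomorphic to $\Ind_{\overline{P}}^G(\hat\pi)$ » (AGIKMS l.11735) /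
« $\widehat{i_P^G(\cdot)} = i_{P^-}^G(\widehat{\cdot})$ » (KMSW l.105), on classes: two substitutions.
[cite: AGIKMS2024, `note30.tex` l.11731–11735; KalethaEtAl2014, `Appendix_Ban.tex` l.103–106; FratilaPrasad2022, Prop. 10.3 (1); BernsteinBezrukavnikovKazhdan2018, Thm 1.1] -/
theorem aubert_dual_of_induced {d : DualityMaps RG RM} (h : PrintedInputs d) (y : RM) :
    d.aubG (d.indP y) = d.indPbar (d.aubM y) := by
  rw [h.dl_eq_dual_contra_G, h.contra_ind, h.dual_ind, ← h.dl_eq_dual_contra_M]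

/-- The same assembly read for the COHOMOLOGICAL involution alone (what [CK26] Prop. 2.5.3 (2) and Bernstein's
item state, and what FP22 Prop. 10.3 (1) prints verbatim): no bridge needed — the printed statement IS the cited
one. [cite: ChengKaletha2026, Prop. 2.5.3 (2) p. 12; FratilaPrasad2022, Prop. 10.3 (1)] -/
theorem cohomological_dual_of_induced {d : DualityMaps RG RM} (h : PrintedInputs d) (y : RM) :
    d.dualG (d.indP y) = d.indPbar (d.dualM y) :=
  h.dual_ind y

/-- Non-vacuity of the signature: a one-point model satisfies the printed inputs (so `PrintedInputs` is
consistent as typed; it says nothing about p-adic groups). [folklore] -/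
example : PrintedInputs (RG := Unit) (RM := Unit)
    { indP := id, indPbar := id, dualG := id, dualM := id, contraG := id, contraM := id, aubG := id, aubM := id } :=
  ⟨fun _ => rfl, fun _ => rfl, fun _ => rfl, fun _ => rfl⟩


/-! ## 5. What the cited notes print at « Theorem 31 » (v1.2, append-only; same unit, 2026-08-21) — a READ REGISTER of
## the unpublished text the three users cite, not a source of facts for the cell

The copy [AGIKMS] cite by URL (bibliography l.16092 « \url{https://personal.math.ubc.ca/~cass/research/pdf/bernstein.pdf} »;
cell text `paper:url-b9440ac3f856`, 110 pp., read 2026-08-21; bib `Bernstein1992Notes`, UNPUBLISHED) is headed (p.1) « DRAFT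
OF: REPRESENTATIONS OF p-ADIC GROUPS / Lectures by Joseph Bernstein / Harvard University, Fall 1992 / Written by Karl E.
Rumelhart » and prints on p.100 (§IV.5.1 « Cohomological Duality », after « E^i(π) = Ext^i(π, H(G)) »): « Theorem 31. Fix a
component Ω ⊂ Ω(G) and let d = dim Ω. Suppose that π ∈ M_f(Ω). Then E^i(π) = 0 unless i = d, and D(π) := E^d(π) is a
representation of finite length. Converting D(π) from a right module to a left module in the standard way gives a map D :
M_f(Ω) → M_f(Ω). The map D is called cohomological duality. It has the following properties: (1) D is exact. (2) D² is the
identity. (3) If ρ is irreducible cuspidal, then D(ρ) ≅ ρ̃. (4) D ∘ i_{G,M} = i_{G,M} ∘ D, where i_{G,M} is taken with the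
oposite [sic] parabolic. (5) D ∘ r_{M,G} = r_{M,G} ∘ D. Remark. It follows that π irreducible imples [sic] D(π)
irreducible. »; p.101 « The proof of theorem 31 will occupy the rest of this section. The proof has two parts. First we show
that E^i(π) = 0 for i ≠ d. Then we prove properties (1) to (5). »; p.104, for (4)/(5): « for projective objects P ∈ M(M) and
Q ∈ M(G). By the second adjunction and Frobenius reciprocity, this is equivalent to (i_{G,M} × 1)H(M) ≅ (1 × r_{M,G})H(G).
Here 1 is the trivial functor. Proof. It is simplest to identify H(G) with locally constant compactly supported
functions on G. Then (1 × r_{M,G})H(G) is functions on G/U and (i_{G,M} × 1)H(M) is functions on G ×_P M ≅ G/U. This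
completes the proof of theorem 31. » — the argument FP22 §10.2 prints in refereed form ((10.4)–(10.7)); next head p.104
« 5.2. Cohen-Macualey Duality. [NOT FINISHED] ».  So, ON THIS COPY: the induction item is (4) — as [AGIKMS] (« 31 (4) ») and
FP22 (« 31(4,5) », induction and restriction) cite it —, item (3) is the cuspidal statement D(ρ) ≅ ρ̃, and [KMSW]'s « 31(3) »
for induction does not match this copy's numbering (another version of the notes, or a slip; not adjudicated).  Nothing in
§§1–4 changes; no census word is touched; the notes remain unpublished and are NOT used as a source anywhere in the cell. -/

/-- The five items of « Theorem 31 » as printed on p.100 of the UBC copy of the notes (item number, text; « oposite »,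
and « imples » in the Remark, are the copy's spellings), plus what each item is about (tag: 1 exact, 2 involutive, 3
cuspidal-contragredient, 4 induction-opposite-parabolic, 5 restriction). A register of an UNPUBLISHED text the users cite;
not a fact of the cell. [cite: Bernstein1992Notes, p.100 Theorem 31 (cell text `paper:url-b9440ac3f856` p0100:L18–L33); AGIKMS2024, `note30.tex` l.16092 (the URL cited)] -/
def notesThm31Items : List (Nat × String × Nat) :=
  [(1, "D is exact.", 1),
   (2, "D^2 is the identity.", 2),
   (3, "If ρ is irreducible cuspidal, then D(ρ) ≅ ρ~.", 3),
   (4, "D ∘ i_{G,M} = i_{G,M} ∘ D, where i_{G,M} is taken with the oposite parabolic.", 4),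
   (5, "D ∘ r_{M,G} = r_{M,G} ∘ D.", 5)]

/-- Does the copy print a proof of Theorem 31 (pp. 101–104: « The proof of theorem 31 will occupy the rest of this section »
… « This completes the proof of theorem 31. »), and is the following head marked unfinished (« 5.2. Cohen-Macualey Duality.
[NOT FINISHED] »)? [cite: Bernstein1992Notes, p.101 (p0101:L15–L17), p.104 (p0104:L14–L20)] -/
def notesThm31ProofPrinted : Bool × Bool := (true, true)

/-- REGISTER FACT (by `decide`) — v1.2.  On the UBC copy of the notes: the induction-with-opposite-parabolic item of Theorem 31
is number 4 and the restriction item number 5; [AGIKMS]'s cited item (4) is the induction item; FP22's pair {4, 5} is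
{induction, restriction}; [KMSW]'s cited number 3 is, on this copy, the cuspidal statement, not induction; the copy prints a
proof of the theorem.  (What another version of the notes numbers is not asserted.)
[cite: Bernstein1992Notes, p.100 Theorem 31; AGIKMS2024, `note30.tex` l.11742 « \cite[Theorem 31 (4)]{Ber} »; KalethaEtAl2014, `Appendix_Ban.tex` l.103 « \cite[Theorem 31(3)]{Bernstein} »; FratilaPrasad2022, §10.2 « [Ber92, Theorem 31(4,5)] »] -/
theorem users_items_vs_notes_copy :
    (notesThm31Items.filter fun t => t.2.2 = 4).map (·.1) = [4]
    ∧ (notesThm31Items.filter fun t => t.2.2 = 5).map (·.1) = [5]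
    ∧ (citation .AGIKMS).2.2.2.1 = 4
    ∧ (citation .KMSW).2.2.2.1 = 3 ∧ (notesThm31Items.filter fun t => t.1 = 3).map (·.2.2) = [3]
    ∧ (thm31ItemsNamed.filter fun x => x.2 = [4, 5]).length = 1
    ∧ notesThm31ProofPrinted = (true, true) := by
  decide

end Literature.NumberTheory.Automorphic.Arthur2013.Leaves.AubertInduction

-- buildfix 2026-08-21 (ops-buildfix-2): comment-only re-land to re-queue the hub build of this module
-- (accepted 06:40-07:30Z but never dispatched to the build lane, HOME LEDGER G11b-3); no declaration changed.
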